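import Mathlib
import Summits.Ventures.HodgeRepro2.T5SplitPlaceCharacters

/-!
# At a split place the norm is surjective, so `η_v = 1`

In the split model of `T5SplitPlaceCharacters` (row 66: `E_v = F_v × F_v` with the swap as
conjugation, `G` a commutative group standing for `F_v^×`), the norm `(a, b) ↦ a · b` — the
product of a pair with its swap, read on the diagonal — is SURJECTIVE onto `G`
(`normHom_surjective`), so the norm group is everything (`range_normHom`) and every character of
`G` trivial on norms is trivial (`eq_one_of_forall_normHom_eq_one`): «`ε_{E/F,v} = 1` at a split
place» (the prose item of row 66), completing the local picture of `η_v` of rows 139 / 142 / 144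
(inert: unramified quadratic; tamely ramified: the Legendre symbol; split: trivial).

Declaration per README §8(d): «uses an L-value-free non-vanishing device: NO».
-/

namespace Summit.Ventures.HodgeRepro2.T5SplitPlaceNormGroup

variable {G : Type*} [CommGroup G]

/-- The norm of the split algebra `G × G` (conjugation = swap): `(a, b) ↦ a · b`. -/
def normHom : G × G →* G where
  toFun p := p.1 * p.2
  map_one' := by simp
  map_mul' := by
    intro p q
    show (p * q).1 * (p * q).2 = p.1 * p.2 * (q.1 * q.2)
    simp only [Prod.fst_mul, Prod.snd_mul]
    exact mul_mul_mul_comm _ _ _ _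

/-- `normHom (a, b) = a * b`. -/
theorem normHom_apply (p : G × G) : normHom p = p.1 * p.2 := rfl

/-- The norm is the product of an element with its swap, read on the first coordinate. -/
theorem normHom_eq_mul_swap (p : G × G) : (p * p.swap).1 = normHom p := by
  simp [normHom_apply]

/-- The norm is SURJECTIVE: `a = normHom (a, 1)`. -/
theorem normHom_surjective : Function.Surjective (normHom : G × G →* G) :=
  fun a => ⟨(a, 1), by simp [normHom_apply]⟩

/-- The norm group is the whole group. -/
theorem range_normHom : (normHom : G × G →* G).range = ⊤ :=
  MonoidHom.range_eq_top.mpr normHom_surjective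

/-- `η_v = 1` AT A SPLIT PLACE: a character of `G` trivial on norms is trivial. -/
theorem eq_one_of_forall_normHom_eq_one {M : Type*} [CommGroup M] (η : G →* M)
    (h : ∀ p : G × G, η (normHom p) = 1) : η = 1 := by
  ext a
  have := h (a, 1)
  simpa [normHom_apply] using this

end Summit.Ventures.HodgeRepro2.T5SplitPlaceNormGroup
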